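import Literature.AlgebraicGeometry.Frobenioids.PerfectionCoAngular
import HarnessLib

/-!
# Frobenioids I, §3: pre-steps of the perfection `C^pf` are monomorphisms (Def. 1.3 (v)(a) for `C^pf`)

Mochizuki, *The geometry of Frobenioids I: the general theory*, Kyushu J. Math. **62** (2008)
293–400, Definition 3.1 (ii)/(iii) p. 56–57, Proposition 3.2 (iii) p. 59 ("`C^pf` is a Frobenioid …")
and Definition 1.3 (v)(a) p. 24 (pre-steps are monomorphisms) [cite: MochizukiFrdI2008, Prop. 3.2 (iii) p.59].

PROOF-ONLY companion of the `C^pf` chain (`Perfection*.lean`).  Towards the (untyped) clause "`C^pf` is a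
Frobenioid" of Prop. 3.2 (iii) — row FrdI:Prop3.2(iii)-frobenioid of the cell — this file supplies:

* the representative-level dictionary for the `Base`/`Div`/`deg_Fr` classes of arrows of `C^pf`: a perfected
  morphism `[r]` is linear / of Frobenius degree `d` / a base-isomorphism / an isometry / a pre-step / an
  isometric pre-step iff its representative `r : A^{(a)} → B^{(b)}` is one in `C` (any representative: the
  classes are transport-invariant, `isPreStep_lift_iff` …);
* **Def. 1.3 (v)(a) for `C^pf`**: a pre-step of `C^pf` is a monomorphism (`mono_of_isPreStep`) — two
  composites `γᵢ ≫ β` that agree are transported to ONE common level, where they become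
  `γᵢ″ ≫ β″` with `β″` a transported representative of `β`, a pre-step of `C`, hence a monomorphism of `C`
  (Def. 1.3 (v)(a) for `C`).

DISCLOSURE.  As in the rest of the chain, only `hF : IsFrobenioid F` is assumed (print's standing hypothesis
"`C` of Frobenius-isotropic type", Def. 3.1 (iii) p. 56, is not needed here).
-/

namespace Literature.AlgebraicGeometry.Frobenioids

namespace PreFrobenioid

namespace Perfection

open CategoryTheory Opposite

universe w v v' u u'

variable {D : Type u} [Category.{v} D] {Φ : Dᵒᵖ ⥤ CommMonCat.{w}}
  {C : Type u'} [Category.{v'} C] {F : C ⥤ ElemFrobenioid Φ} {hF : IsFrobenioid F}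
  {X Y Z : Perfection hF}

/-! ### The representative-level dictionary -/

/-- `[r]` has Frobenius degree `d` iff `r` has. [cite: MochizukiFrdI2008, Prop. 3.2 (i) p.58] -/
theorem hasDegree_mk_iff (r : Rep X Y) (d : ℕ+) :
    (ops hF).HasDegree d (X := X) (Y := Y) (Hom.mk r) ↔ PreFrobenioid.degFr F r.hom = d := Iff.rfl

/-- `[r]` is linear iff `r` is. [cite: MochizukiFrdI2008, Prop. 3.2 (ii) p.59] -/
theorem isLinear_mk_iff (r : Rep X Y) :
    (ops hF).IsLinear (X := X) (Y := Y) (Hom.mk r) ↔ IsLinear F r.hom := Iff.rfl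

/-- `[r]` is a base-isomorphism iff `r` is. [cite: MochizukiFrdI2008, Prop. 3.2 (ii) p.59] -/
theorem isBaseIso_mk_iff (r : Rep X Y) :
    (ops hF).IsBaseIso (X := X) (Y := Y) (Hom.mk r) ↔ IsBaseIso F r.hom :=
  (isIso_base_hom_iff r).symm

/-- `[r]` is an isometry iff `r` is. [cite: MochizukiFrdI2008, Prop. 3.2 (ii) p.59] -/
theorem isIsometry_mk_iff (r : Rep X Y) :
    (ops hF).IsIsometry (X := X) (Y := Y) (Hom.mk r) ↔ IsIsometry F r.hom :=
  div_eq_one_iff r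

/-- `[r]` is a pre-step iff `r` is. [cite: MochizukiFrdI2008, Prop. 3.2 (ii) p.59] -/
theorem isPreStep_mk_iff (r : Rep X Y) :
    (ops hF).IsPreStep (X := X) (Y := Y) (Hom.mk r) ↔ IsPreStep F r.hom :=
  and_congr (isLinear_mk_iff r) (isBaseIso_mk_iff r)

/-- `[r]` is an isometric pre-step iff `r` is a pre-step and an isometry.
[cite: MochizukiFrdI2008, Prop. 3.2 (ii) p.59] -/
theorem isIsometricPreStep_mk_iff (r : Rep X Y) :
    (ops hF).IsIsometricPreStep (X := X) (Y := Y) (Hom.mk r) ↔ IsPreStep F r.hom ∧ IsIsometry F r.hom :=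
  and_congr (isPreStep_mk_iff r) (isIsometry_mk_iff r)

/-- Transport preserves and reflects pre-steps. [cite: MochizukiFrdI2008, Prop. 1.10 (i) p.34] -/
theorem isPreStep_lift_iff (r : Rep X Y) (L : Level X Y) (h : r.L.LE L) :
    IsPreStep F (Level.lift r.L L h r.hom) ↔ IsPreStep F r.hom := by
  rw [← isPreStep_mk_iff ⟨L, Level.lift r.L L h r.hom⟩, Hom.mk_lift, isPreStep_mk_iff]

/-- Transport preserves and reflects isometries. [cite: MochizukiFrdI2008, Prop. 1.10 (i) p.34] -/
theorem isIsometry_lift_iff (r : Rep X Y) (L : Level X Y) (h : r.L.LE L) :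
    IsIsometry F (Level.lift r.L L h r.hom) ↔ IsIsometry F r.hom := by
  rw [← isIsometry_mk_iff ⟨L, Level.lift r.L L h r.hom⟩, Hom.mk_lift, isIsometry_mk_iff]

/-- Transport preserves and reflects base-isomorphisms. [cite: MochizukiFrdI2008, Prop. 1.10 (i) p.34] -/
theorem isBaseIso_lift_iff (r : Rep X Y) (L : Level X Y) (h : r.L.LE L) :
    IsBaseIso F (Level.lift r.L L h r.hom) ↔ IsBaseIso F r.hom := by
  rw [← isBaseIso_mk_iff ⟨L, Level.lift r.L L h r.hom⟩, Hom.mk_lift, isBaseIso_mk_iff]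

/-! ### A common level for two parallel representatives followed by a third -/

/-- Two parallel representatives `g₁, g₂ : Z ⇉ X` and one `b : X → Y` admit a common triple level.
[cite: MochizukiFrdI2008, Def. 3.1 (iii) p.57] -/
theorem exists_level₃ (g₁ g₂ : Rep Z X) (b : Rep X Y) :
    ∃ T : Level₃ Z X Y, g₁.L.LE T.fst ∧ g₂.L.LE T.fst ∧ b.L.LE T.snd := by
  have hsw : g₁.L.b * g₂.L.a = g₂.L.b * g₁.L.a := by
    apply mul_left_cancel (a := X.idx)
    calc X.idx * (g₁.L.b * g₂.L.a) = X.idx * g₁.L.b * g₂.L.a := by rw [mul_assoc]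
      _ = Z.idx * g₁.L.a * g₂.L.a := by rw [g₁.L.eq]
      _ = Z.idx * g₂.L.a * g₁.L.a := by ac_rfl
      _ = X.idx * g₂.L.b * g₁.L.a := by rw [g₂.L.eq]
      _ = X.idx * (g₂.L.b * g₁.L.a) := by rw [mul_assoc]
  have eq₁ : Z.idx * (g₁.L.a * g₂.L.a * b.L.a) = X.idx * (g₁.L.b * g₂.L.a * b.L.a) := by
    rw [← mul_assoc, ← mul_assoc, ← mul_assoc, ← mul_assoc, g₁.L.eq]
  have eq₂ : X.idx * (g₁.L.b * g₂.L.a * b.L.a) = Y.idx * (g₁.L.b * g₂.L.a * b.L.b) := by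
    calc X.idx * (g₁.L.b * g₂.L.a * b.L.a) = X.idx * b.L.a * (g₁.L.b * g₂.L.a) := by ac_rfl
      _ = Y.idx * b.L.b * (g₁.L.b * g₂.L.a) := by rw [b.L.eq]
      _ = Y.idx * (g₁.L.b * g₂.L.a * b.L.b) := by ac_rfl
  refine ⟨⟨_, _, _, eq₁, eq₂⟩, ⟨Dvd.intro (g₂.L.a * b.L.a) (mul_assoc _ _ _).symm,
    Dvd.intro (g₂.L.a * b.L.a) (mul_assoc _ _ _).symm⟩, ⟨Dvd.intro (g₁.L.a * b.L.a) ?_,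
    Dvd.intro (g₁.L.a * b.L.a) ?_⟩, ⟨dvd_mul_left _ _, dvd_mul_left _ _⟩⟩
  · change g₂.L.a * (g₁.L.a * b.L.a) = g₁.L.a * g₂.L.a * b.L.a
    ac_rfl
  · change g₂.L.b * (g₁.L.a * b.L.a) = g₁.L.b * g₂.L.a * b.L.a
    rw [← mul_assoc, ← hsw]

/-! ### Def. 1.3 (v)(a) for `C^pf` -/

/-- **Pre-steps of `C^pf` are monomorphisms** (Def. 1.3 (v)(a) for the perfection).
[cite: MochizukiFrdI2008, Prop. 3.2 (iii) p.59] -/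
theorem mono_of_isPreStep {β : X ⟶ Y} (hβ : (ops hF).IsPreStep β) : Mono β := by
  obtain ⟨b, rfl⟩ := Hom.mk_surjective β
  refine ⟨fun {Z} γ₁ γ₂ e => ?_⟩
  obtain ⟨g₁, rfl⟩ := Hom.mk_surjective γ₁
  obtain ⟨g₂, rfl⟩ := Hom.mk_surjective γ₂
  obtain ⟨T, h₁, h₂, hb⟩ := exists_level₃ g₁ g₂ b
  -- both composites at the common triple level
  have e' : Hom.mk ⟨T.out, compAt T g₁ b h₁ hb⟩ = Hom.mk ⟨T.out, compAt T g₂ b h₂ hb⟩ := by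
    rw [mk_compAt T g₁ b h₁ hb, mk_compAt T g₂ b h₂ hb]
    exact e
  obtain ⟨M, hM₁, hM₂, eM⟩ := Hom.mk_eq_mk.mp e'
  -- scale the triple level by `t := M.a * M.b`
  let t : ℕ+ := M.a * M.b
  let L₁ : Level Z X := ⟨T.a * t, T.b * t, by rw [← mul_assoc, T.eq₁, mul_assoc]⟩
  let L₂ : Level X Y := ⟨T.b * t, T.c * t, by rw [← mul_assoc, T.eq₂, mul_assoc]⟩
  let L : Level Z Y := ⟨T.a * t, T.c * t, by rw [← mul_assoc, T.eq₁.trans T.eq₂, mul_assoc]⟩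
  have k₁ : T.fst.LE L₁ := ⟨dvd_mul_right _ _, dvd_mul_right _ _⟩
  have k₂ : T.snd.LE L₂ := ⟨dvd_mul_right _ _, dvd_mul_right _ _⟩
  have hL : T.out.LE L := ⟨dvd_mul_right _ _, dvd_mul_right _ _⟩
  have hML : M.LE L :=
    ⟨(Dvd.intro M.b rfl : M.a ∣ t).trans (dvd_mul_left _ _),
      (Dvd.intro M.a (mul_comm _ _) : M.b ∣ t).trans (dvd_mul_left _ _)⟩
  have eL := lift_eq_lift_of_le hM₁ hM₂ eM hML hL hL
  change Level.lift T.out L hL (compAt T g₁ b h₁ hb) = Level.lift T.out L hL (compAt T g₂ b h₂ hb) at eL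
  unfold compAt Level.lift at eL
  rw [liftLevel_comp hF _ _ hL.1 k₁.2 hL.2 (Level.degFr_eq T.fst L₁ k₁) (Level.degFr_eq T.snd L₂ k₂),
    liftLevel_comp hF _ _ hL.1 k₁.2 hL.2 (Level.degFr_eq T.fst L₁ k₁) (Level.degFr_eq T.snd L₂ k₂)] at eL
  -- the transported representative of `β` is a pre-step of `C`, hence a monomorphism
  have hb'' : IsPreStep F (Level.lift T.snd L₂ k₂ (Level.lift b.L T.snd hb b.hom)) := by
    rw [isPreStep_lift_iff ⟨T.snd, Level.lift b.L T.snd hb b.hom⟩ L₂ k₂]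
    exact (isPreStep_lift_iff b T.snd hb).mpr ((isPreStep_mk_iff b).mp hβ)
  haveI := hF.v_a _ hb''
  have eγ : Level.lift T.fst L₁ k₁ (Level.lift g₁.L T.fst h₁ g₁.hom) =
      Level.lift T.fst L₁ k₁ (Level.lift g₂.L T.fst h₂ g₂.hom) := by
    rw [← cancel_mono (Level.lift T.snd L₂ k₂ (Level.lift b.L T.snd hb b.hom))]
    exact eL
  -- back to `C^pf`
  rw [← Hom.mk_lift g₁ T.fst h₁, ← Hom.mk_lift ⟨T.fst, Level.lift g₁.L T.fst h₁ g₁.hom⟩ L₁ k₁,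
    ← Hom.mk_lift g₂ T.fst h₂, ← Hom.mk_lift ⟨T.fst, Level.lift g₂.L T.fst h₂ g₂.hom⟩ L₁ k₁]
  exact congrArg (fun φ => Hom.mk (X := Z) (Y := X) ⟨L₁, φ⟩) eγ

end Perfection

end PreFrobenioid

end Literature.AlgebraicGeometry.Frobenioids
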